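import Literature.MathematicalPhysics.QuantumFieldTheory.Balaban1983to89.B6RandomWalkHom

/-!
# `Balaban1983to89.B6RandomWalkBlocks` — [Balaban1984PropagatorsII] (2.51)–(2.55) p. 232 «this property is preserved under the composition
# of operators possessing it» for operators BETWEEN TWO function spaces: the full 2×2 block operator `(A B; C D)` on the functions on a
# disjoint union `X ⊕ Y`, so that pv08's ONE-carrier block-majorant calculus (`B6RandomWalk.HasMajorant`, every device of the cell built
# on it) applies verbatim to words whose letters map sites ↦ bonds ↦ sites ↦ … (e.g. `P₁(A) = (D_{U′U} − D_U)P(U)D*_U + …` of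
# [Balaban1985BackgroundPropagators] (3.76), whose letters `D`, `D*`, `P` live between the site and the bond carrier)

statement-level skeleton of published theorems with citation tags; proofs where landed; nothing here is a claim about the Yang–Mills mass gap

CITATION HEADER (lean-in-tree rule).  [4] = T. Bałaban, *Propagators and renormalization transformations for lattice gauge theories. II*,
Commun. Math. Phys. **96** (1984) 223–250 [Balaban1984PropagatorsII] (cell paper B6; journal page = PDF page + 222), (2.51)–(2.55)
p. 232: «this property is preserved under the composition of operators possessing it» / «A summation preserves it also» — the
block-majorant calculus; B9 = T. Bałaban, *Propagators for lattice gauge theories in a background field*, CMP **99** (1985) 389–434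
[Balaban1985BackgroundPropagators], (3.42) p. 397 (entries of operators from site functions to bond functions, `∇_UG′(U)`) and (3.76)
p. 405 (the word `P₁(A)`).  Cell `lit-balaban`, seat r06 (B9 fold owner) gen 11; SKELETON rows B9.Eq3.76 × B6 (2.51)–(2.55).
WHY: `B6RandomWalkHom` (pv-seat b09/b11) typed TWO of the four blocks — `emb R S = (R 0; S 0)` (right fixed points with a left entry)
and `embL V T = (V T; 0 0)` — which suffices for words with ONE inter-space letter; the (3.76) words `E·P·D*` (sites → bonds ∘ sites
→ sites ∘ bonds → sites) need all four blocks and their multiplication table.  This module is that bookkeeping, nothing more.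

WHAT THIS FILE PROVES (0 sorry; one definition with body + theorems; [folklore] linear algebra).
* `emb₄ A B C D : Module.End ℝ (X ⊕ Y → ℝ)` — the block operator `f ↦ (A(f|_X) + B(f|_Y), C(f|_X) + D(f|_Y))` for `A : End X`, `B : Y →
  X`, `C : X → Y`, `D : End Y` (`_apply_inl/_inr` rfl); `emb₄_mul` (THE MULTIPLICATION TABLE `(A B; C D)(A′ B′; C′ D′) = (AA′ + BC′,
  AB′ + BD′; CA′ + DC′, CB′ + DD′)`), `emb₄_add`, `emb₄_sub`, `emb₄_neg`, `emb₄_zero`, `emb₄_smul`; `emb_eq_emb₄`, `embL_eq_emb₄` (the two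
  partial embeddings of `B6RandomWalkHom` are `(R 0; S 0)` and `(V T; 0 0)`).
* TO pv08: `hasMajorant_emb₄` — majorants `K_A` (of `A`), `K_B` (two-space, of `B`), `K_C`, `K_D` with `K_A + K_B ≦ K` and `K_C + K_D ≦ K`
  give the pv08 majorant `K` of `(A B; C D)` over the block map `Sum.elim blkX blkY`; the one-block corollaries `hasMajorant_emb₄_inl_inl`,
  `hasMajorant_emb₄_inl_inr`, `hasMajorant_emb₄_inr_inl`, `hasMajorant_emb₄_inr_inr` (the other three blocks `0`, `K ≧ 0`).
* FROM pv08: `hasMajorant_of_emb₄_inl_inl` (`A`), `hasMajorantHom_of_emb₄_inl_inr` (`B`), `hasMajorantHom_of_emb₄_inr_inl` (`C`),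
  `hasMajorant_of_emb₄_inr_inr` (`D`) — a pv08 majorant of the block operator is a majorant of each block (test functions extended by
  `0` from one summand).

HONEST SCOPE / NOT CLAIMED.  Pure bookkeeping ([folklore]); no estimate of [4] or B9 is proved here.  Value = lets the one-carrier devices
(`B9Ineq377POne.ineq377_op`, `B9Ineq386CommSum`, …) consume concrete letters typed between the site and bond carriers; NOT summit progress.

RELATED IN THE TREE, NOT DUPLICATED (searched 2026-08-21: `lean search 'emb₄|hasMajorant_emb₄|emb₄_mul'` = ∅; the name `blk4` is TAKEN by `T4ConstrainedAgmonD.blk4` (a block MAP `Torus4 K n → Blocks4 K`), hence `emb₄`; an unrelated index map `emb4` lives under `Summits/CriticalPhenomena/…`; `B6RandomWalkHom.emb`/`embL`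
are the partial embeddings — related to `emb₄` by `emb_eq_emb₄`/`embL_eq_emb₄`, not restated; `B4GaugeCovariance.blockOp` is a matrix
block construction for a different purpose).
-/

namespace Literature.MathematicalPhysics.QuantumFieldTheory.Balaban1983to89.B6RandomWalkBlocks

open Literature.MathematicalPhysics.QuantumFieldTheory.Balaban1983to89
open B6RandomWalk B6RandomWalkHom

noncomputable section

/-! ## §1  The 2×2 block operator and its algebra -/

section Blocks

variable {X Y : Type}

/-- **The block operator `(A B; C D)` on the functions on `X ⊕ Y`**: `f ↦ (A(f|_X) + B(f|_Y), C(f|_X) + D(f|_Y))` — ONE endomorphism carrying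
four letters typed between the two function spaces ([4] p. 232: operators between block spaces, composed). [folklore]
[cite: Balaban1984PropagatorsII, (2.51)–(2.55) p.232] -/
def emb₄ (A : Module.End ℝ (X → ℝ)) (B : (Y → ℝ) →ₗ[ℝ] (X → ℝ)) (C : (X → ℝ) →ₗ[ℝ] (Y → ℝ)) (D : Module.End ℝ (Y → ℝ)) :
    Module.End ℝ (X ⊕ Y → ℝ) where
  toFun f := Sum.elim (A (f ∘ Sum.inl) + B (f ∘ Sum.inr)) (C (f ∘ Sum.inl) + D (f ∘ Sum.inr))
  map_add' f f' := by
    have h1 : (f + f') ∘ Sum.inl = f ∘ Sum.inl + f' ∘ Sum.inl := rfl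
    have h2 : (f + f') ∘ Sum.inr = f ∘ Sum.inr + f' ∘ Sum.inr := rfl
    simp only [h1, h2, map_add]
    funext z
    rcases z with x | v
    · simp only [Sum.elim_inl, Pi.add_apply]; abel
    · simp only [Sum.elim_inr, Pi.add_apply]; abel
  map_smul' c f := by
    have h1 : (c • f) ∘ Sum.inl = c • (f ∘ Sum.inl) := rfl
    have h2 : (c • f) ∘ Sum.inr = c • (f ∘ Sum.inr) := rfl
    simp only [h1, h2, map_smul, RingHom.id_apply]
    funext z
    rcases z with x | v
    · simp only [Sum.elim_inl, Pi.add_apply, Pi.smul_apply, smul_add]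
    · simp only [Sum.elim_inr, Pi.add_apply, Pi.smul_apply, smul_add]

/-- The `X`-component of `(A B; C D)f`. [folklore] [cite: Balaban1984PropagatorsII, (2.51) p.232] -/
@[simp] theorem emb₄_apply_inl (A : Module.End ℝ (X → ℝ)) (B : (Y → ℝ) →ₗ[ℝ] (X → ℝ)) (C : (X → ℝ) →ₗ[ℝ] (Y → ℝ))
    (D : Module.End ℝ (Y → ℝ)) (f : X ⊕ Y → ℝ) (x : X) :
    emb₄ A B C D f (Sum.inl x) = A (f ∘ Sum.inl) x + B (f ∘ Sum.inr) x :=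
  rfl

/-- The `Y`-component of `(A B; C D)f`. [folklore] [cite: Balaban1984PropagatorsII, (2.51) p.232] -/
@[simp] theorem emb₄_apply_inr (A : Module.End ℝ (X → ℝ)) (B : (Y → ℝ) →ₗ[ℝ] (X → ℝ)) (C : (X → ℝ) →ₗ[ℝ] (Y → ℝ))
    (D : Module.End ℝ (Y → ℝ)) (f : X ⊕ Y → ℝ) (v : Y) :
    emb₄ A B C D f (Sum.inr v) = C (f ∘ Sum.inl) v + D (f ∘ Sum.inr) v :=
  rfl

/-- Restricting `(A B; C D)f` to `X`. [folklore] [cite: Balaban1984PropagatorsII, (2.51) p.232] -/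
theorem emb₄_comp_inl (A : Module.End ℝ (X → ℝ)) (B : (Y → ℝ) →ₗ[ℝ] (X → ℝ)) (C : (X → ℝ) →ₗ[ℝ] (Y → ℝ))
    (D : Module.End ℝ (Y → ℝ)) (f : X ⊕ Y → ℝ) :
    (emb₄ A B C D f) ∘ Sum.inl = A (f ∘ Sum.inl) + B (f ∘ Sum.inr) :=
  rfl

/-- Restricting `(A B; C D)f` to `Y`. [folklore] [cite: Balaban1984PropagatorsII, (2.51) p.232] -/
theorem emb₄_comp_inr (A : Module.End ℝ (X → ℝ)) (B : (Y → ℝ) →ₗ[ℝ] (X → ℝ)) (C : (X → ℝ) →ₗ[ℝ] (Y → ℝ))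
    (D : Module.End ℝ (Y → ℝ)) (f : X ⊕ Y → ℝ) :
    (emb₄ A B C D f) ∘ Sum.inr = C (f ∘ Sum.inl) + D (f ∘ Sum.inr) :=
  rfl

/-- **THE MULTIPLICATION TABLE** `(A B; C D)(A′ B′; C′ D′) = (AA′ + BC′, AB′ + BD′; CA′ + DC′, CB′ + DD′)` — «this property is preserved under
the composition of operators» read for typed letters: products in the one-carrier calculus ARE the compositions of the blocks.
[folklore] [cite: Balaban1984PropagatorsII, (2.52)–(2.55) p.232] -/
theorem emb₄_mul (A A' : Module.End ℝ (X → ℝ)) (B B' : (Y → ℝ) →ₗ[ℝ] (X → ℝ)) (C C' : (X → ℝ) →ₗ[ℝ] (Y → ℝ))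
    (D D' : Module.End ℝ (Y → ℝ)) :
    emb₄ A B C D * emb₄ A' B' C' D'
      = emb₄ (A * A' + B ∘ₗ C') (A ∘ₗ B' + B ∘ₗ D') (C ∘ₗ A' + D ∘ₗ C') (C ∘ₗ B' + D * D') := by
  apply LinearMap.ext
  intro f
  funext z
  rcases z with x | v
  · simp only [Module.End.mul_apply, emb₄_apply_inl, emb₄_comp_inl, emb₄_comp_inr, map_add, LinearMap.add_apply,
      LinearMap.comp_apply, Pi.add_apply]
    abel
  · simp only [Module.End.mul_apply, emb₄_apply_inr, emb₄_comp_inl, emb₄_comp_inr, map_add, LinearMap.add_apply,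
      LinearMap.comp_apply, Pi.add_apply, Module.End.mul_apply]
    abel

/-- Block addition. [folklore] [cite: Balaban1984PropagatorsII, p.232] -/
theorem emb₄_add (A A' : Module.End ℝ (X → ℝ)) (B B' : (Y → ℝ) →ₗ[ℝ] (X → ℝ)) (C C' : (X → ℝ) →ₗ[ℝ] (Y → ℝ))
    (D D' : Module.End ℝ (Y → ℝ)) :
    emb₄ A B C D + emb₄ A' B' C' D' = emb₄ (A + A') (B + B') (C + C') (D + D') := by
  apply LinearMap.ext
  intro f
  funext z
  rcases z with x | v
  · simp only [LinearMap.add_apply, Pi.add_apply, emb₄_apply_inl]; abel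
  · simp only [LinearMap.add_apply, Pi.add_apply, emb₄_apply_inr]; abel

/-- Block negation. [folklore] [cite: Balaban1984PropagatorsII, p.232] -/
theorem emb₄_neg (A : Module.End ℝ (X → ℝ)) (B : (Y → ℝ) →ₗ[ℝ] (X → ℝ)) (C : (X → ℝ) →ₗ[ℝ] (Y → ℝ)) (D : Module.End ℝ (Y → ℝ)) :
    -emb₄ A B C D = emb₄ (-A) (-B) (-C) (-D) := by
  apply LinearMap.ext
  intro f
  funext z
  rcases z with x | v
  · simp only [LinearMap.neg_apply, Pi.neg_apply, emb₄_apply_inl]; abel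
  · simp only [LinearMap.neg_apply, Pi.neg_apply, emb₄_apply_inr]; abel

/-- Block subtraction. [folklore] [cite: Balaban1984PropagatorsII, p.232] -/
theorem emb₄_sub (A A' : Module.End ℝ (X → ℝ)) (B B' : (Y → ℝ) →ₗ[ℝ] (X → ℝ)) (C C' : (X → ℝ) →ₗ[ℝ] (Y → ℝ))
    (D D' : Module.End ℝ (Y → ℝ)) :
    emb₄ A B C D - emb₄ A' B' C' D' = emb₄ (A - A') (B - B') (C - C') (D - D') := by
  rw [sub_eq_add_neg, emb₄_neg, emb₄_add]
  simp only [← sub_eq_add_neg]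

/-- The zero block operator. [folklore] [cite: Balaban1984PropagatorsII, p.232] -/
theorem emb₄_zero : emb₄ (0 : Module.End ℝ (X → ℝ)) (0 : (Y → ℝ) →ₗ[ℝ] (X → ℝ)) (0 : (X → ℝ) →ₗ[ℝ] (Y → ℝ))
    (0 : Module.End ℝ (Y → ℝ)) = 0 := by
  apply LinearMap.ext
  intro f
  funext z
  rcases z with x | v
  · simp only [emb₄_apply_inl, LinearMap.zero_apply, Pi.zero_apply, add_zero]
  · simp only [emb₄_apply_inr, LinearMap.zero_apply, Pi.zero_apply, add_zero]

/-- Real scalar multiples of a block operator. [folklore] [cite: Balaban1984PropagatorsII, p.232] -/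
theorem emb₄_smul (r : ℝ) (A : Module.End ℝ (X → ℝ)) (B : (Y → ℝ) →ₗ[ℝ] (X → ℝ)) (C : (X → ℝ) →ₗ[ℝ] (Y → ℝ))
    (D : Module.End ℝ (Y → ℝ)) :
    r • emb₄ A B C D = emb₄ (r • A) (r • B) (r • C) (r • D) := by
  apply LinearMap.ext
  intro f
  funext z
  rcases z with x | v
  · simp only [LinearMap.smul_apply, Pi.smul_apply, emb₄_apply_inl, smul_add]
  · simp only [LinearMap.smul_apply, Pi.smul_apply, emb₄_apply_inr, smul_add]

/-- `B6RandomWalkHom.emb R S` is the block operator `(R 0; S 0)`. [folklore] [cite: Balaban1984PropagatorsII, (2.51) p.232] -/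
theorem emb_eq_emb₄ (R : Module.End ℝ (X → ℝ)) (S : (X → ℝ) →ₗ[ℝ] (Y → ℝ)) :
    emb R S = emb₄ R 0 S 0 := by
  apply LinearMap.ext
  intro f
  funext z
  rcases z with x | v
  · simp only [emb_apply_inl, emb₄_apply_inl, LinearMap.zero_apply, Pi.zero_apply, add_zero]
  · simp only [emb_apply_inr, emb₄_apply_inr, LinearMap.zero_apply, Pi.zero_apply, add_zero]

/-- `B6RandomWalkHom.embL V T` is the block operator `(V T; 0 0)`. [folklore] [cite: Balaban1984PropagatorsII, (2.51) p.232] -/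
theorem embL_eq_emb₄ (V : Module.End ℝ (X → ℝ)) (T : (Y → ℝ) →ₗ[ℝ] (X → ℝ)) :
    embL V T = emb₄ V T 0 0 := by
  apply LinearMap.ext
  intro f
  funext z
  rcases z with x | v
  · rfl
  · simp only [emb₄_apply_inr, LinearMap.zero_apply, Pi.zero_apply, add_zero]; rfl

end Blocks

/-! ## §2  The dictionary with pv08's majorants over the block map `Sum.elim blkX blkY` -/

section Majorants

variable {g : B6.Geometry} {X Y : Type}

/-- **TO pv08**: majorants `K_A` of `A`, `K_B` of `B : Y → X` (two-space), `K_C` of `C : X → Y`, `K_D` of `D` with `K_A + K_B ≦ K` and `K_C +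
K_D ≦ K` give the pv08 majorant `K` of `(A B; C D)` over `Sum.elim blkX blkY` (a test function block-supported at `y′` on `X ⊕ Y` restricts
to block-supported test functions on `X` and on `Y` with the same bound). [folklore] [cite: Balaban1984PropagatorsII, (2.51)–(2.52) p.232] -/
theorem hasMajorant_emb₄ {blkX : X → g.Site} {blkY : Y → g.Site} {A : Module.End ℝ (X → ℝ)} {B : (Y → ℝ) →ₗ[ℝ] (X → ℝ)}
    {C : (X → ℝ) →ₗ[ℝ] (Y → ℝ)} {D : Module.End ℝ (Y → ℝ)} {KA KB KC KD K : g.Site → g.Site → ℝ}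
    (hA : HasMajorant blkX A KA) (hB : HasMajorantHom blkY blkX B KB) (hC : HasMajorantHom blkX blkY C KC)
    (hD : HasMajorant blkY D KD) (hKX : ∀ a b, KA a b + KB a b ≤ K a b) (hKY : ∀ a b, KC a b + KD a b ≤ K a b) :
    HasMajorant (Sum.elim blkX blkY) (emb₄ A B C D) K := by
  intro y' μ M hμ z
  have hμX : BlockSupp blkX (μ ∘ Sum.inl) y' M := blockSupp_compInl hμ
  have hμY : BlockSupp blkY (μ ∘ Sum.inr) y' M := blockSupp_compInr hμ
  rcases z with x | v
  · show |A (μ ∘ Sum.inl) x + B (μ ∘ Sum.inr) x| ≤ K (blkX x) y' * M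
    refine (abs_add_le _ _).trans ?_
    have h1 := hA y' _ M hμX x
    have h2 := hB y' _ M hμY x
    have := hKX (blkX x) y'
    nlinarith [hμ.nonneg]
  · show |C (μ ∘ Sum.inl) v + D (μ ∘ Sum.inr) v| ≤ K (blkY v) y' * M
    refine (abs_add_le _ _).trans ?_
    have h1 := hC y' _ M hμX v
    have h2 := hD y' _ M hμY v
    have := hKY (blkY v) y'
    nlinarith [hμ.nonneg]

/-- TO pv08, one block: `(A 0; 0 0)` has the majorants `K ≧ 0` of `A`. [folklore] [cite: Balaban1984PropagatorsII, (2.51) p.232] -/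
theorem hasMajorant_emb₄_inl_inl {blkX : X → g.Site} {blkY : Y → g.Site} {A : Module.End ℝ (X → ℝ)} {K : g.Site → g.Site → ℝ}
    (hA : HasMajorant blkX A K) (hK : ∀ a b, 0 ≤ K a b) :
    HasMajorant (Sum.elim blkX blkY) (emb₄ A (0 : (Y → ℝ) →ₗ[ℝ] (X → ℝ)) (0 : (X → ℝ) →ₗ[ℝ] (Y → ℝ)) 0) K :=
  hasMajorant_emb₄ hA (hasMajorantHom_zero blkY blkX) (hasMajorantHom_zero blkX blkY)
    ((hasMajorantHom_iff blkY 0 _).mp (hasMajorantHom_zero blkY blkY)) (fun a b => by simp) (fun a b => by simpa using hK a b)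

/-- TO pv08, one block: `(0 B; 0 0)` has the two-space majorants `K ≧ 0` of `B : Y → X`. [folklore] [cite: Balaban1984PropagatorsII, (2.51) p.232] -/
theorem hasMajorant_emb₄_inl_inr {blkX : X → g.Site} {blkY : Y → g.Site} {B : (Y → ℝ) →ₗ[ℝ] (X → ℝ)} {K : g.Site → g.Site → ℝ}
    (hB : HasMajorantHom blkY blkX B K) (hK : ∀ a b, 0 ≤ K a b) :
    HasMajorant (Sum.elim blkX blkY) (emb₄ (0 : Module.End ℝ (X → ℝ)) B (0 : (X → ℝ) →ₗ[ℝ] (Y → ℝ)) 0) K :=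
  hasMajorant_emb₄ ((hasMajorantHom_iff blkX 0 _).mp (hasMajorantHom_zero blkX blkX)) hB (hasMajorantHom_zero blkX blkY)
    ((hasMajorantHom_iff blkY 0 _).mp (hasMajorantHom_zero blkY blkY)) (fun a b => by simp) (fun a b => by simpa using hK a b)

/-- TO pv08, one block: `(0 0; C 0)` has the two-space majorants `K ≧ 0` of `C : X → Y`. [folklore] [cite: Balaban1984PropagatorsII, (2.51) p.232] -/
theorem hasMajorant_emb₄_inr_inl {blkX : X → g.Site} {blkY : Y → g.Site} {C : (X → ℝ) →ₗ[ℝ] (Y → ℝ)} {K : g.Site → g.Site → ℝ}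
    (hC : HasMajorantHom blkX blkY C K) (hK : ∀ a b, 0 ≤ K a b) :
    HasMajorant (Sum.elim blkX blkY) (emb₄ (0 : Module.End ℝ (X → ℝ)) (0 : (Y → ℝ) →ₗ[ℝ] (X → ℝ)) C 0) K :=
  hasMajorant_emb₄ ((hasMajorantHom_iff blkX 0 _).mp (hasMajorantHom_zero blkX blkX)) (hasMajorantHom_zero blkY blkX) hC
    ((hasMajorantHom_iff blkY 0 _).mp (hasMajorantHom_zero blkY blkY)) (fun a b => by simpa using hK a b) (fun a b => by simp)

/-- TO pv08, one block: `(0 0; 0 D)` has the majorants `K ≧ 0` of `D`. [folklore] [cite: Balaban1984PropagatorsII, (2.51) p.232] -/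
theorem hasMajorant_emb₄_inr_inr {blkX : X → g.Site} {blkY : Y → g.Site} {D : Module.End ℝ (Y → ℝ)} {K : g.Site → g.Site → ℝ}
    (hD : HasMajorant blkY D K) (hK : ∀ a b, 0 ≤ K a b) :
    HasMajorant (Sum.elim blkX blkY) (emb₄ (0 : Module.End ℝ (X → ℝ)) (0 : (Y → ℝ) →ₗ[ℝ] (X → ℝ)) (0 : (X → ℝ) →ₗ[ℝ] (Y → ℝ)) D)
      K :=
  hasMajorant_emb₄ ((hasMajorantHom_iff blkX 0 _).mp (hasMajorantHom_zero blkX blkX)) (hasMajorantHom_zero blkY blkX)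
    (hasMajorantHom_zero blkX blkY) hD (fun a b => by simpa using hK a b) (fun a b => by simp)

/-- **FROM pv08, block `A`**: a pv08 majorant of `(A B; C D)` over `X ⊕ Y` is a majorant of `A` (test functions extended by `0` from `X`).
[folklore] [cite: Balaban1984PropagatorsII, (2.51) p.232] -/
theorem hasMajorant_of_emb₄_inl_inl {blkX : X → g.Site} {blkY : Y → g.Site} {A : Module.End ℝ (X → ℝ)} {B : (Y → ℝ) →ₗ[ℝ] (X → ℝ)}
    {C : (X → ℝ) →ₗ[ℝ] (Y → ℝ)} {D : Module.End ℝ (Y → ℝ)} {K : g.Site → g.Site → ℝ}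
    (h : HasMajorant (Sum.elim blkX blkY) (emb₄ A B C D) K) : HasMajorant blkX A K := by
  intro y' μ M hμ x
  have := h y' (Sum.elim μ 0) M (blockSupp_sumElim hμ) (Sum.inl x)
  simpa [emb₄_apply_inl] using this

/-- **FROM pv08, block `B`**: a pv08 majorant of `(A B; C D)` is a two-space majorant of `B : Y → X` (test functions extended by `0` from `Y`).
[folklore] [cite: Balaban1984PropagatorsII, (2.51) p.232] -/
theorem hasMajorantHom_of_emb₄_inl_inr {blkX : X → g.Site} {blkY : Y → g.Site} {A : Module.End ℝ (X → ℝ)}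
    {B : (Y → ℝ) →ₗ[ℝ] (X → ℝ)} {C : (X → ℝ) →ₗ[ℝ] (Y → ℝ)} {D : Module.End ℝ (Y → ℝ)} {K : g.Site → g.Site → ℝ}
    (h : HasMajorant (Sum.elim blkX blkY) (emb₄ A B C D) K) : HasMajorantHom blkY blkX B K := by
  intro y' μ M hμ x
  have := h y' (Sum.elim 0 μ) M (blockSupp_sumElim_right hμ) (Sum.inl x)
  simpa [emb₄_apply_inl] using this

/-- **FROM pv08, block `C`**: a pv08 majorant of `(A B; C D)` is a two-space majorant of `C : X → Y`. [folklore] [cite: Balaban1984PropagatorsII, (2.51) p.232] -/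
theorem hasMajorantHom_of_emb₄_inr_inl {blkX : X → g.Site} {blkY : Y → g.Site} {A : Module.End ℝ (X → ℝ)}
    {B : (Y → ℝ) →ₗ[ℝ] (X → ℝ)} {C : (X → ℝ) →ₗ[ℝ] (Y → ℝ)} {D : Module.End ℝ (Y → ℝ)} {K : g.Site → g.Site → ℝ}
    (h : HasMajorant (Sum.elim blkX blkY) (emb₄ A B C D) K) : HasMajorantHom blkX blkY C K := by
  intro y' μ M hμ v
  have := h y' (Sum.elim μ 0) M (blockSupp_sumElim hμ) (Sum.inr v)
  simpa [emb₄_apply_inr] using this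

/-- **FROM pv08, block `D`**: a pv08 majorant of `(A B; C D)` is a majorant of `D`. [folklore] [cite: Balaban1984PropagatorsII, (2.51) p.232] -/
theorem hasMajorant_of_emb₄_inr_inr {blkX : X → g.Site} {blkY : Y → g.Site} {A : Module.End ℝ (X → ℝ)} {B : (Y → ℝ) →ₗ[ℝ] (X → ℝ)}
    {C : (X → ℝ) →ₗ[ℝ] (Y → ℝ)} {D : Module.End ℝ (Y → ℝ)} {K : g.Site → g.Site → ℝ}
    (h : HasMajorant (Sum.elim blkX blkY) (emb₄ A B C D) K) : HasMajorant blkY D K := by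
  intro y' μ M hμ v
  have := h y' (Sum.elim 0 μ) M (blockSupp_sumElim_right hμ) (Sum.inr v)
  simpa [emb₄_apply_inr] using this

end Majorants

end

end Literature.MathematicalPhysics.QuantumFieldTheory.Balaban1983to89.B6RandomWalkBlocks
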